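import Literature.MathematicalPhysics.QuantumLattice.HubbardOneBandHoppingFamilies
import Literature.MathematicalPhysics.QuantumLattice.HubbardKineticEnergyDensity
import HarnessLib

/-!
# Lattice symmetries of one-band hopping families: pullback of a whole family, sublattice-embedding
# monotonicity, invariance under lattice automorphisms, and the UNIAXIAL-STRAIN CAP
# `e_ρ(t_x, t_y, t', U) ≤ energyDensityTT' ((t_x+t_y)/2) t' U ρ`

Topic `Literature/MathematicalPhysics/QuantumLattice` (family `hubbard`; §1–§4 general dimension `d`, §5 `ℤ²`).
Sequel of `LatticeVectorHoppingInteraction` (pullback of one bond energy, `K_v(ω ∘ Γ_f) = K_{f(v)}(ω)`) and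
`HubbardOneBandHoppingFamilies` (`hubbardHoppingFamily τ₁ τ₂ U θ`, joint concavity in `θ`). Written for stage
S2 (CERTIFIER-FAMILIES, «families of models») of the Hubbard material-oracle programme and the phase map's
«strain» tag (HORIZON-BREAK §13 (C): uniaxial strain is an external axis — in a one-band model it splits the
nearest-neighbour hopping into `t_x ≠ t_y`). The method is the seat's: a lattice SYMMETRY makes the concave
energy density symmetric in two couplings, and a symmetric concave function is maximal at the symmetric
point — so the certified energy density of the UNSTRAINED model caps every strained one with the same mean
hopping, at zero cost.

* §1 the on-site term under pullback: `Re (ω ∘ Γ_f)(n_{0↑}n_{0↓}) = Re ω(n_{0↑}n_{0↓})` (`f 0 = 0`), the support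
  / range-independence of `Φ^{0,U}` (`hubbardFermionInteraction_zero_apply_eq_zero_of_not_subset`,
  `meanEnergy_onSite_eq_one`), `e_{Φ^{0,U}}(ω) = U·D(ω)` for translation-invariant `ω`, hence
  `e_{Φ^{0,U}}(ω ∘ Γ_f) = e_{Φ^{0,U}}(ω)` (`IsTranslationInvariant.meanEnergy_onSite_mapAct`).
* §2 **PULLBACK OF A FAMILY**: `e_{Ψ_{τ₁,τ₂}(θ)}(ω ∘ Γ_f) = e_{Ψ_{f∘τ₁,f∘τ₂}(θ)}(ω)` for translation-invariant `ω`
  and injective additive `f` (`IsTranslationInvariant.meanEnergy_hubbardHoppingFamily_mapAct`); consequences: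
  **SUBLATTICE-EMBEDDING MONOTONICITY** `e_ρ(Ψ_τ) ≤ e_ρ(Ψ_{f∘τ})` for every injective additive `f : ℤ^d → ℤ^d`
  (`tiGroundEnergyDensityAt_hubbardHoppingFamily_le_comp`; the general form of the tree's checkerboard floor
  `energyDensityTT'_nn_le_diag`) and **LATTICE-SYMMETRY INVARIANCE** `e_ρ(Ψ_{f∘τ}) = e_ρ(Ψ_τ)` whenever `f`
  has an injective additive left inverse (`tiGroundEnergyDensityAt_hubbardHoppingFamily_comp_eq`; reflections,
  rotations, inversion).
* §3 bookkeeping identities of families: re-indexing the couplings (`hubbardHoppingFamily_reindex`), swapping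
  the members of the pairs (`_swap`), replacing jumps by their negatives (`_congr_neg`).
* §4 `concaveOn_le_map_midpoint_of_eq`: a concave `F` with `F x = F y` has `F x ≤ F(½x + ½y)`.
* §5 (`ℤ²`) the reflection `swapReflection : (x,y) ↦ (y,x)` (an involutive injective additive map), the
  **uniaxially strained `t–t'–U` interaction** `hubbardStrainedTTPrimeFermionInteraction t_x t_y t' U` (pairs
  `(e₁|e₁), (e₂|e₂), (e₁+e₂|e₁−e₂)` at `θ = (t_x/2, t_y/2, t')`; at `t_x = t_y = t` it IS
  `hubbardTTPrimeFermionInteraction t t' U`, term by term), the `x ↔ y` symmetry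
  `e_ρ(t_x,t_y,t',U) = e_ρ(t_y,t_x,t',U)`, **THE STRAIN CAP `e_ρ(t_x,t_y,t',U) ≤ e_ρ(t̄,t̄,t',U)`,
  `t̄ = (t_x+t_y)/2`** (every filling), its certified form `… ≤ energyDensityTT' t̄ t' U ρ` (`U ≥ 0`,
  `0 < ρ < 2`; `…_le_of_cap`), and the kinematic floor `energyDensityTT' t̄ t' U ρ − 2|t_x − t_y| ≤ e_ρ(t_x,t_y,t',U)`
  (norm row; the strained pairs `(e_i|e_i)` are not rank-2, so the `16/π²` pair row does not apply to them).

Everything is PROVED; definitions with bodies (`swapReflection`, `strainPair₁/₂`,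
`hubbardStrainedTTPrimeFermionInteraction`), no named fact, no number of record, no `sorry`. HONEST SCOPE:
energy words only; the cap is one-sided (strain LOWERS the model's ground-state energy density at fixed mean
hopping; how much is bounded only kinematically here); a strained MATERIAL also changes `t̄`, `t'`, `U` — that
is the S1 box's business; nothing bears on order / pairing words.

## Mathlib / tree search

REUSED: `vectorHoppingFermionInteraction(_neg/_eq_smul_one)`, `latticePairMap`, `pairMap_apply`, `InfVolFermionState.meanEnergy_vectorHopping_mapAct`,
`hubbardFermionInteraction_apply_eq_onSite_add_sum_vectorHopping`, `diagHoppingFermionInteraction_apply_eq_sum_vectorHopping`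
(`LatticeVectorHoppingInteraction`); `hoppingPairInteraction(_apply)`, `hubbardHoppingFamily`, `InfVolFermionState.meanEnergy_hoppingPair`,
`concaveOn_tiGroundEnergyDensityAt_hubbardHoppingFamily`, `abs_infMeanEnergyOn_hubbardHoppingFamily_sub_le_norm` (`HubbardOneBandHoppingFamilies`);
`InfVolFermionState.mapAct`, `mapAct_expect`, `IsTranslationInvariant.mapAct`, `density_mapAct`, `PolySite.mapEmb_pt`, `mapSet`,
`neg_mem_thicken_zero` (`InfVolFermionStateLatticeMapPullback` / prequel); `IsTranslationInvariant.hubbardEnergyDensity_eq_docc_add_hopping`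
(`HubbardKineticEnergyDensity`); `InfVolFermionState.meanEnergy_eq_of_le` (`HubbardTTPrimeTPPFillingTransport`); `hubbardFermionInteraction_apply_pair/
_apply_eq_zero`, `unitVec_mem_thicken_one`, `fermionEmbed_numberOp` ; `diagVec(_ne_zero, _mem_thicken_one)`, `hubbardTTPrimeFermionInteraction_apply`;
`FermionInteraction.le_tiGroundEnergyDensityAt`, `tiGroundEnergyDensityAt_le_meanEnergy`, `tiGroundEnergyDensityAt_eq_infMeanEnergyOn`,
`infMeanEnergyOn_empty`, `meanEnergy_linearFamily`, `linearFamily_apply`, `tiGroundEnergyDensityAt_hubbardTTPrime_eq_energyDensityTT'`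
(`TIGroundEnergyDensityCouplingFamilies`); `Equiv.sum_comp`, `Equiv.swap`. `lean search 'strain|swapReflection|anisotrop' --decl`
(QuantumLattice): nothing relevant (`energyDensityTT'_neg_t`, `energyDensityTT'_nn_le_diag` are the nearest symmetry statements).

## References

* R. B. Israel, *Convexity in the Theory of Lattice Gases* (1979), Thm. I.3.4 (concavity of ground-state /
  free energies in the interaction). [cite: Israel1979, Thm. I.3.4]
* O. Bratteli, A. Kishimoto, D. W. Robinson, CMP 64 (1978) 41, §3 and Thm. 2 (mean energy, invariant
  ground states as minimisers). [cite: BratteliKishimotoRobinson1978, Thm. 2 (condition 2)]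
* O. Bratteli, D. W. Robinson, *OAQSM 1* (1987), §4.3.1 (states composed with morphisms of the quasi-local
  algebra). [cite: BratteliRobinsonI1987, §4.3.1]
* H. Araki, H. Moriya, Rev. Math. Phys. 15 (2003) 93, §4.1 (site maps of the CAR algebra). [cite: ArakiMoriya2003, §4.1]
* R. T. Rockafellar, *Convex Analysis* (1970), Thm. 32.2. [cite: Rockafellar1970, Thm 32.2]
* E. Pavarini et al., PRL 87 (2001) 047003, eq. (1). [cite: PavariniEtAl2001, eq. (1)]
-/

noncomputable section

namespace Literature.MathematicalPhysics.QuantumLattice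

open Matrix Finset HubbardWave0 Literature.Probability.LatticeModels ThermodynamicLimit
open scoped ComplexOrder BigOperators

/-! ### §1. The on-site term under pullback: `D(ω ∘ Γ_f) = D(ω)` and `e_{Φ^{0,U}}(ω ∘ Γ_f) = e_{Φ^{0,U}}(ω)` -/

section OnSite

variable {d d' : ℕ}

/-- **The double-occupancy density is preserved by every pullback fixing the origin** (`f 0 = 0`):
`Re (ω ∘ Γ_f)(n_{0↑}n_{0↓}) = Re ω(n_{0↑}n_{0↓})`. [cite: ArakiMoriya2003, §4.1] -/
theorem InfVolFermionState.re_expect_docc_mapAct (ω : InfVolFermionState d') (f : Site d → Site d')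
    (hf : Function.Injective f) (h0 : f 0 = 0) :
    ((ω.mapAct f hf).expect {0} (nAt (0 : Site d) (mem_singleton_self 0) 0 * nAt 0 (mem_singleton_self 0) 1)).re =
      (ω.expect {0} (nAt (0 : Site d') (mem_singleton_self 0) 0 * nAt 0 (mem_singleton_self 0) 1)).re := by
  have hmem : (0 : Site d') ∈ mapSet f ({0} : Finset (Site d)) := by
    rw [← h0]; exact mem_mapSet_of_mem f (mem_singleton_self 0)
  have hsub : ({0} : Finset (Site d')) ⊆ mapSet f ({0} : Finset (Site d)) := singleton_subset_iff.2 hmem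
  have hpt : PolySite.mapEmb f hf ({0} : Finset (Site d)) (PolySite.pt 0 (mem_singleton_self 0)) =
      PolySite.incl hsub (PolySite.pt 0 (mem_singleton_self 0)) := by
    rw [PolySite.mapEmb_pt, PolySite.incl_pt]; exact PolySite.pt_congr _ _ h0
  have hn : ∀ σ : Fin 2, fermionEmbed (PolySite.mapEmb f hf ({0} : Finset (Site d)))
      (nAt (0 : Site d) (mem_singleton_self 0) σ) =
        fermionEmbed (PolySite.incl hsub) (nAt (0 : Site d') (mem_singleton_self 0) σ) := by
    intro σ
    rw [nAt, nAt, fermionEmbed_numberOp, fermionEmbed_numberOp, hpt]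
  rw [InfVolFermionState.mapAct_expect, map_mul, hn 0, hn 1, ← map_mul, ω.compatible hsub]

/-- **Support of the pure on-site interaction**: a term `Φ^{0,U} X ≠ 0` with `0 ∈ X` has `X = {0} ⊆ thicken {0} R`
(every range parameter). [cite: arXiv9311033, §2 (the Hubbard Hamiltonian)] -/
theorem hubbardFermionInteraction_zero_apply_eq_zero_of_not_subset (U : ℝ) {R : ℝ} {X : Finset (Site d)}
    (h0 : (0 : Site d) ∈ X) (hX : ¬ X ⊆ thicken ({0} : Finset (Site d)) R) :
    (hubbardFermionInteraction d 0 U).Φ X = 0 := by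
  by_cases hpair : ∃ (x : Site d) (i : Fin d), X = {x, x + unitVec i}
  · obtain ⟨x, i, rfl⟩ := hpair
    rw [hubbardFermionInteraction_apply_pair, Complex.ofReal_zero, neg_zero, zero_smul]
  · push Not at hpair
    refine hubbardFermionInteraction_apply_eq_zero 0 U (fun x hx => hX ?_) hpair
    rw [hx] at h0 ⊢
    rw [mem_singleton] at h0
    rw [← h0]
    exact singleton_subset_iff.2 (zero_mem_thicken_zero R)

/-- **The on-site mean energy does not depend on the range parameter**: `e_{Φ^{0,U}}^{(R)}(ω) = e_{Φ^{0,U}}^{(1)}(ω)`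
for every `R ≥ 1` (and, by the same support argument, for every `R ≥ 0`). [cite: BratteliKishimotoRobinson1978, §3 (mean energy functional)] -/
theorem InfVolFermionState.meanEnergy_onSite_eq_one (ω : InfVolFermionState d) (U : ℝ) {R : ℝ} (hR : 1 ≤ R) :
    ω.meanEnergy (hubbardFermionInteraction d 0 U) R = ω.meanEnergy (hubbardFermionInteraction d 0 U) 1 :=
  ω.meanEnergy_eq_of_le _ hR fun _ h0 hX => hubbardFermionInteraction_zero_apply_eq_zero_of_not_subset U h0 hX

/-- **`e_{Φ^{0,U}}(ω) = U · D(ω)` for every translation-invariant state** (`D(ω) = Re ω(n_{0↑}n_{0↓})`; the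
hopping part of `hubbardEnergyDensity_eq_docc_add_hopping` is absent at `t = 0`). [cite: BratteliRobinsonII1997, §6.2.4] -/
theorem InfVolFermionState.IsTranslationInvariant.meanEnergy_onSite_eq_mul_docc {ω : InfVolFermionState d}
    (hω : ω.IsTranslationInvariant) (U : ℝ) :
    ω.meanEnergy (hubbardFermionInteraction d 0 U) 1 =
      U * (ω.expect {0} (nAt (0 : Site d) (mem_singleton_self 0) 0 * nAt 0 (mem_singleton_self 0) 1)).re := by
  have h := hω.hubbardEnergyDensity_eq_docc_add_hopping 0 U
  rw [InfVolFermionState.hubbardEnergyDensity] at h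
  rw [h]
  simp only [neg_zero, zero_mul, Finset.sum_const_zero, add_zero]

/-- **PULLBACK OF THE ON-SITE ENERGY**: for a translation-invariant `ω` on `ℤ^{d'}` and an injective additive
`f : ℤ^d → ℤ^{d'}`, `e_{Φ^{0,U}}^{(R)}(ω ∘ Γ_f) = e_{Φ^{0,U}}^{(R')}(ω)` (`R, R' ≥ 1`). [cite: BratteliRobinsonI1987, §4.3.1] -/
theorem InfVolFermionState.IsTranslationInvariant.meanEnergy_onSite_mapAct {ω : InfVolFermionState d'}
    (hω : ω.IsTranslationInvariant) (f : Site d →+ Site d') (hf : Function.Injective f) (U : ℝ) {R R' : ℝ}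
    (hR : 1 ≤ R) (hR' : 1 ≤ R') :
    (ω.mapAct f hf).meanEnergy (hubbardFermionInteraction d 0 U) R = ω.meanEnergy (hubbardFermionInteraction d' 0 U) R' := by
  rw [(ω.mapAct f hf).meanEnergy_onSite_eq_one U hR, ω.meanEnergy_onSite_eq_one U hR',
    (hω.mapAct f hf).meanEnergy_onSite_eq_mul_docc U, hω.meanEnergy_onSite_eq_mul_docc U,
    ω.re_expect_docc_mapAct f hf (map_zero f)]

end OnSite

/-! ### §2. Pullback of a whole hopping family: `e_{Ψ_τ(θ)}(ω ∘ Γ_f) = e_{Ψ_{f∘τ}(θ)}(ω)` -/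

section FamilyPullback

variable {d d' : ℕ} {ι : Type*} [Fintype ι]

/-- **PULLBACK OF A HOPPING FAMILY.** For a translation-invariant `ω` on `ℤ^{d'}`, an injective additive
`f : ℤ^d → ℤ^{d'}` and pairs of nonzero jumps inside the range boxes:
`e_{Ψ_{τ₁,τ₂}(θ)}^{(R)}(ω ∘ Γ_f) = e_{Ψ_{f∘τ₁, f∘τ₂}(θ)}^{(R')}(ω)` — the pulled-back state sees the family with
jumps `τ` exactly as `ω` sees the family with jumps `f ∘ τ`. [cite: BratteliRobinsonI1987, §4.3.1] -/
theorem InfVolFermionState.IsTranslationInvariant.meanEnergy_hubbardHoppingFamily_mapAct {ω : InfVolFermionState d'}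
    (hω : ω.IsTranslationInvariant) (f : Site d →+ Site d') (hf : Function.Injective f) {τ₁ τ₂ : ι → Site d}
    (h₁ : ∀ a, τ₁ a ≠ 0) (h₂ : ∀ a, τ₂ a ≠ 0) {R R' : ℝ} (hR : 1 ≤ R) (hR' : 1 ≤ R')
    (hR₁ : ∀ a, τ₁ a ∈ thicken ({0} : Finset (Site d)) R) (hR₂ : ∀ a, τ₂ a ∈ thicken ({0} : Finset (Site d)) R)
    (hR₁' : ∀ a, f (τ₁ a) ∈ thicken ({0} : Finset (Site d')) R')
    (hR₂' : ∀ a, f (τ₂ a) ∈ thicken ({0} : Finset (Site d')) R') (U : ℝ) (θ : ι → ℝ) :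
    (ω.mapAct f hf).meanEnergy (hubbardHoppingFamily τ₁ τ₂ U θ) R =
      ω.meanEnergy (hubbardHoppingFamily (f ∘ τ₁) (f ∘ τ₂) U θ) R' := by
  rw [hubbardHoppingFamily, hubbardHoppingFamily, InfVolFermionState.meanEnergy_linearFamily,
    InfVolFermionState.meanEnergy_linearFamily, hω.meanEnergy_onSite_mapAct f hf U hR hR']
  refine congrArg _ (Finset.sum_congr rfl fun a _ => ?_)
  rw [InfVolFermionState.meanEnergy_hoppingPair, InfVolFermionState.meanEnergy_hoppingPair, Function.comp_apply,
    Function.comp_apply,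
    ω.meanEnergy_vectorHopping_mapAct f hf (h₁ a) 1 (hR₁ a) (hR₁' a),
    ω.meanEnergy_vectorHopping_mapAct f hf (h₂ a) 1 (hR₂ a) (hR₂' a)]

/-- **SUBLATTICE-EMBEDDING MONOTONICITY** (the general form of `energyDensityTT'_nn_le_diag`): for an injective
additive `f : ℤ^d → ℤ^d`, the fixed-filling ground-state energy density of the family with jumps `τ` is AT MOST
that of the family with jumps `f ∘ τ` — every translation-invariant state of filling `ρ` pulls back to one of
the same filling whose `τ`-energy is its `f∘τ`-energy. [cite: BratteliKishimotoRobinson1978, Thm. 2 (condition 2)] -/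
theorem tiGroundEnergyDensityAt_hubbardHoppingFamily_le_comp (f : Site d →+ Site d) (hf : Function.Injective f)
    {τ₁ τ₂ : ι → Site d} (h₁ : ∀ a, τ₁ a ≠ 0) (h₂ : ∀ a, τ₂ a ≠ 0) {R R' : ℝ} (hR : 1 ≤ R) (hR' : 1 ≤ R')
    (hR₁ : ∀ a, τ₁ a ∈ thicken ({0} : Finset (Site d)) R) (hR₂ : ∀ a, τ₂ a ∈ thicken ({0} : Finset (Site d)) R)
    (hR₁' : ∀ a, f (τ₁ a) ∈ thicken ({0} : Finset (Site d)) R')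
    (hR₂' : ∀ a, f (τ₂ a) ∈ thicken ({0} : Finset (Site d)) R') (U : ℝ) (θ : ι → ℝ) (ρ : ℝ) :
    (hubbardHoppingFamily τ₁ τ₂ U θ).tiGroundEnergyDensityAt R ρ ≤
      (hubbardHoppingFamily (f ∘ τ₁) (f ∘ τ₂) U θ).tiGroundEnergyDensityAt R' ρ := by
  rcases ({ω : InfVolFermionState d | ω.IsTranslationInvariant ∧ ω.density = ρ}).eq_empty_or_nonempty with h | hS
  · rw [FermionInteraction.tiGroundEnergyDensityAt_eq_infMeanEnergyOn, FermionInteraction.tiGroundEnergyDensityAt_eq_infMeanEnergyOn,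
      h, FermionInteraction.infMeanEnergyOn_empty, FermionInteraction.infMeanEnergyOn_empty]
  obtain ⟨ω₀, hω₀⟩ := hS
  refine FermionInteraction.le_tiGroundEnergyDensityAt _ _ ⟨ω₀, hω₀⟩ fun ω hω hρ => ?_
  rw [← hω.meanEnergy_hubbardHoppingFamily_mapAct f hf h₁ h₂ hR hR' hR₁ hR₂ hR₁' hR₂' U θ]
  exact FermionInteraction.tiGroundEnergyDensityAt_le_meanEnergy _ _ (hω.mapAct f hf)
    (by rw [InfVolFermionState.density_mapAct ω f hf (map_zero f), hρ])

/-- **LATTICE-SYMMETRY INVARIANCE.** If `f` has an injective additive left inverse `g` (`g ∘ f = id`; e.g. `f`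
a lattice automorphism — reflection, rotation, inversion — with `g = f⁻¹`), then the fixed-filling
ground-state energy densities of the families with jumps `τ` and `f ∘ τ` COINCIDE.
[cite: BratteliKishimotoRobinson1978, Thm. 2 (condition 2)] -/
theorem tiGroundEnergyDensityAt_hubbardHoppingFamily_comp_eq (f g : Site d →+ Site d) (hf : Function.Injective f)
    (hg : Function.Injective g) (hgf : ∀ x, g (f x) = x)
    {τ₁ τ₂ : ι → Site d} (h₁ : ∀ a, τ₁ a ≠ 0) (h₂ : ∀ a, τ₂ a ≠ 0) {R : ℝ} (hR : 1 ≤ R)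
    (hR₁ : ∀ a, τ₁ a ∈ thicken ({0} : Finset (Site d)) R) (hR₂ : ∀ a, τ₂ a ∈ thicken ({0} : Finset (Site d)) R)
    (hR₁' : ∀ a, f (τ₁ a) ∈ thicken ({0} : Finset (Site d)) R)
    (hR₂' : ∀ a, f (τ₂ a) ∈ thicken ({0} : Finset (Site d)) R) (U : ℝ) (θ : ι → ℝ) (ρ : ℝ) :
    (hubbardHoppingFamily (f ∘ τ₁) (f ∘ τ₂) U θ).tiGroundEnergyDensityAt R ρ =
      (hubbardHoppingFamily τ₁ τ₂ U θ).tiGroundEnergyDensityAt R ρ := by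
  refine le_antisymm ?_ (tiGroundEnergyDensityAt_hubbardHoppingFamily_le_comp f hf h₁ h₂ hR hR hR₁ hR₂ hR₁' hR₂' U θ ρ)
  have hf0 : ∀ {v : Site d}, v ≠ 0 → f v ≠ 0 := fun {v} hv h => hv (hf (by rw [h, map_zero]))
  have hback₁ : g ∘ (f ∘ τ₁) = τ₁ := funext fun a => hgf (τ₁ a)
  have hback₂ : g ∘ (f ∘ τ₂) = τ₂ := funext fun a => hgf (τ₂ a)
  have h := tiGroundEnergyDensityAt_hubbardHoppingFamily_le_comp g hg (τ₁ := f ∘ τ₁) (τ₂ := f ∘ τ₂)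
    (fun a => hf0 (h₁ a)) (fun a => hf0 (h₂ a)) hR hR hR₁' hR₂'
    (fun a => by rw [Function.comp_apply, hgf]; exact hR₁ a) (fun a => by rw [Function.comp_apply, hgf]; exact hR₂ a) U θ ρ
  rwa [hback₁, hback₂] at h

end FamilyPullback

/-! ### §3. Re-indexing and re-pairing a family (bookkeeping identities) -/

section Reindex

variable {d : ℕ} {ι ι' : Type*} [Fintype ι] [Fintype ι']

/-- **Re-indexing the couplings**: `Ψ_{τ∘e}(θ∘e) = Ψ_τ(θ)` for an index bijection `e`. [cite: KomaTasaki1994, §1] -/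
theorem hubbardHoppingFamily_reindex (e : ι' ≃ ι) (τ₁ τ₂ : ι → Site d) (U : ℝ) (θ : ι → ℝ) :
    hubbardHoppingFamily (τ₁ ∘ e) (τ₂ ∘ e) U (θ ∘ e) = hubbardHoppingFamily τ₁ τ₂ U θ := by
  refine FermionInteraction.ext fun X => ?_
  simp only [hubbardHoppingFamily, FermionInteraction.linearFamily_apply, Function.comp_apply]
  exact congrArg _ (e.sum_comp (fun a => ((θ a : ℝ) : ℂ) • (hoppingPairInteraction d (τ₁ a) (τ₂ a)).Φ X))

/-- **The order inside a pair is immaterial**: `Ψ_{τ₂,τ₁} = Ψ_{τ₁,τ₂}`. [cite: PavariniEtAl2001, eq. (1)] -/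
theorem hubbardHoppingFamily_swap (τ₁ τ₂ : ι → Site d) (U : ℝ) (θ : ι → ℝ) :
    hubbardHoppingFamily τ₂ τ₁ U θ = hubbardHoppingFamily τ₁ τ₂ U θ := by
  refine FermionInteraction.ext fun X => ?_
  simp only [hubbardHoppingFamily, FermionInteraction.linearFamily_apply, hoppingPairInteraction_apply, add_comm]

/-- **Jumps may be replaced by their negatives** (same bond classes): if `σ₁ a = ±τ₁ a` and `σ₂ a = ±τ₂ a` for
every `a`, the families coincide. [cite: PavariniEtAl2001, eq. (1)] -/
theorem hubbardHoppingFamily_congr_neg {σ₁ σ₂ τ₁ τ₂ : ι → Site d} (h₁ : ∀ a, σ₁ a = τ₁ a ∨ σ₁ a = -τ₁ a)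
    (h₂ : ∀ a, σ₂ a = τ₂ a ∨ σ₂ a = -τ₂ a) (U : ℝ) (θ : ι → ℝ) :
    hubbardHoppingFamily σ₁ σ₂ U θ = hubbardHoppingFamily τ₁ τ₂ U θ := by
  refine FermionInteraction.ext fun X => ?_
  simp only [hubbardHoppingFamily, FermionInteraction.linearFamily_apply, hoppingPairInteraction_apply]
  refine congrArg _ (Finset.sum_congr rfl fun a _ => ?_)
  have e₁ : vectorHoppingFermionInteraction d (σ₁ a) 1 = vectorHoppingFermionInteraction d (τ₁ a) 1 := by
    rcases h₁ a with h | h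
    · rw [h]
    · rw [h, vectorHoppingFermionInteraction_neg]
  have e₂ : vectorHoppingFermionInteraction d (σ₂ a) 1 = vectorHoppingFermionInteraction d (τ₂ a) 1 := by
    rcases h₂ a with h | h
    · rw [h]
    · rw [h, vectorHoppingFermionInteraction_neg]
  rw [e₁, e₂]

end Reindex

/-! ### §4. Symmetrisation: a concave function that is symmetric is capped by its value at the symmetric point -/

section Symmetrise

variable {E : Type*} [AddCommGroup E] [Module ℝ E]

/-- **Even + concave ⇒ maximal at the midpoint**: if `F` is concave and `F x = F y`, then
`F x ≤ F (½x + ½y)`. [cite: Rockafellar1970, Thm 32.2] -/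
theorem concaveOn_le_map_midpoint_of_eq {F : E → ℝ} (hF : ConcaveOn ℝ Set.univ F) {x y : E} (h : F x = F y) :
    F x ≤ F ((1 / 2 : ℝ) • x + (1 / 2 : ℝ) • y) := by
  have h2 := hF.2 (Set.mem_univ x) (Set.mem_univ y) (by norm_num : (0 : ℝ) ≤ 1 / 2) (by norm_num : (0 : ℝ) ≤ 1 / 2)
    (by norm_num)
  rw [smul_eq_mul, smul_eq_mul, ← h] at h2
  linarith

end Symmetrise

/-! ### §5. The square lattice: `x ↔ y` symmetry and the UNIAXIAL-STRAIN CAP `e_ρ(t_x, t_y, t', U) ≤ e(t̄, t', U, ρ)` -/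

section Strain

/-- The reflection `(x, y) ↦ (y, x)` of `ℤ²` as an additive map (`e₀ ↦ e₁`, `e₁ ↦ e₀`). [cite: ArakiMoriya2003, §4.1] -/
def swapReflection : Site 2 →+ Site 2 := latticePairMap (unitVec 1) (unitVec 0)

/-- `swapReflection x = (x₁, x₀)`. [cite: ArakiMoriya2003, §4.1] -/
theorem swapReflection_apply (x : Site 2) : swapReflection x = ![x 1, x 0] := by
  ext i
  fin_cases i <;> simp [swapReflection, pairMap_apply, unitVec]

/-- The reflection is an involution. [cite: ArakiMoriya2003, §4.1] -/
theorem swapReflection_swapReflection (x : Site 2) : swapReflection (swapReflection x) = x := by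
  ext i
  fin_cases i <;> simp [swapReflection_apply]

/-- The reflection is injective. [cite: ArakiMoriya2003, §4.1] -/
theorem swapReflection_injective : Function.Injective swapReflection :=
  Function.LeftInverse.injective swapReflection_swapReflection

/-- The pairs of the STRAINED `t–t'` family: `(e₁ | e₁)` (amplitude `t_x/2` twice), `(e₂ | e₂)` (`t_y/2` twice),
`(e₁+e₂ | e₁−e₂)` (`t'`). First members. [cite: PavariniEtAl2001, eq. (1)] -/
def strainPair₁ : Fin 3 → Site 2 := ![unitVec 0, unitVec 1, diagVec 0]

/-- Second members of the strained-family pairs. [cite: PavariniEtAl2001, eq. (1)] -/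
def strainPair₂ : Fin 3 → Site 2 := ![unitVec 0, unitVec 1, diagVec 1]

/-- **The uniaxially strained `t–t'–U` interaction** `Φ^{t_x,t_y,t',U}`: nearest-neighbour hopping `t_x` along
`e₁`, `t_y` along `e₂`, diagonal hopping `t'`, on-site `U` (the strained family at `θ = (t_x/2, t_y/2, t')`).
[cite: PavariniEtAl2001, eq. (1)] -/
def hubbardStrainedTTPrimeFermionInteraction (tx ty t' U : ℝ) : FermionInteraction 2 :=
  hubbardHoppingFamily strainPair₁ strainPair₂ U ![tx / 2, ty / 2, t']

/-- The strained-family jumps are nonzero (first members). [cite: PavariniEtAl2001, eq. (1)] -/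
theorem strainPair₁_ne_zero (a : Fin 3) : strainPair₁ a ≠ 0 := by
  fin_cases a
  · exact uvec_ne_zero 0
  · exact uvec_ne_zero 1
  · exact diagVec_ne_zero 0

/-- The strained-family jumps are nonzero (second members). [cite: PavariniEtAl2001, eq. (1)] -/
theorem strainPair₂_ne_zero (a : Fin 3) : strainPair₂ a ≠ 0 := by
  fin_cases a
  · exact uvec_ne_zero 0
  · exact uvec_ne_zero 1
  · exact diagVec_ne_zero 1

/-- The strained-family jumps lie in `[-1,1]²` (first members). [cite: FriedliVelenik2017, §3.2] -/
theorem strainPair₁_mem_thicken_one (a : Fin 3) : strainPair₁ a ∈ thicken ({0} : Finset (Site 2)) 1 := by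
  fin_cases a
  · exact unitVec_mem_thicken_one 0
  · exact unitVec_mem_thicken_one 1
  · exact diagVec_mem_thicken_one 0

/-- The strained-family jumps lie in `[-1,1]²` (second members). [cite: FriedliVelenik2017, §3.2] -/
theorem strainPair₂_mem_thicken_one (a : Fin 3) : strainPair₂ a ∈ thicken ({0} : Finset (Site 2)) 1 := by
  fin_cases a
  · exact unitVec_mem_thicken_one 0
  · exact unitVec_mem_thicken_one 1
  · exact diagVec_mem_thicken_one 1

/-- The reflection permutes the strained-family jumps: first members go to `strainPair₁ ∘ swap(0,1)`.
[cite: ArakiMoriya2003, §4.1] -/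
theorem swapReflection_strainPair₁ (a : Fin 3) :
    swapReflection (strainPair₁ a) = strainPair₁ (Equiv.swap (0 : Fin 3) 1 a) := by
  fin_cases a <;> (ext i; fin_cases i <;> simp [swapReflection_apply, strainPair₁, unitVec, diagVec, Equiv.swap_apply_def])

/-- … and second members go to `± strainPair₂ ∘ swap(0,1)` (the diagonal `e₁ − e₂` is reversed).
[cite: ArakiMoriya2003, §4.1] -/
theorem swapReflection_strainPair₂ (a : Fin 3) :
    swapReflection (strainPair₂ a) = strainPair₂ (Equiv.swap (0 : Fin 3) 1 a) ∨
      swapReflection (strainPair₂ a) = -strainPair₂ (Equiv.swap (0 : Fin 3) 1 a) := by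
  fin_cases a
  · left; ext i; fin_cases i <;> simp [swapReflection_apply, strainPair₂, unitVec]
  · left; ext i; fin_cases i <;> simp [swapReflection_apply, strainPair₂, unitVec]
  · right; ext i; fin_cases i <;> simp [swapReflection_apply, strainPair₂, diagVec, Equiv.swap_apply_of_ne_of_ne]

/-- **`x ↔ y` SYMMETRY of the strained energy density**: `e_ρ(t_x, t_y, t', U) = e_ρ(t_y, t_x, t', U)` at every
filling. [cite: BratteliKishimotoRobinson1978, Thm. 2 (condition 2)] -/
theorem tiGroundEnergyDensityAt_strained_swap (tx ty t' U ρ : ℝ) :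
    (hubbardStrainedTTPrimeFermionInteraction tx ty t' U).tiGroundEnergyDensityAt 1 ρ =
      (hubbardStrainedTTPrimeFermionInteraction ty tx t' U).tiGroundEnergyDensityAt 1 ρ := by
  -- pull back along the reflection: jumps `τ` become `r ∘ τ = (± τ) ∘ swap`, i.e. the couplings are swapped
  have hfam : hubbardHoppingFamily (swapReflection ∘ strainPair₁) (swapReflection ∘ strainPair₂) U ![tx / 2, ty / 2, t'] =
      hubbardStrainedTTPrimeFermionInteraction ty tx t' U := by
    rw [hubbardHoppingFamily_congr_neg (σ₁ := swapReflection ∘ strainPair₁) (σ₂ := swapReflection ∘ strainPair₂)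
        (τ₁ := strainPair₁ ∘ Equiv.swap (0 : Fin 3) 1)
        (τ₂ := strainPair₂ ∘ Equiv.swap (0 : Fin 3) 1) (fun a => Or.inl (swapReflection_strainPair₁ a))
        (fun a => swapReflection_strainPair₂ a),
      show (![tx / 2, ty / 2, t'] : Fin 3 → ℝ) = (![ty / 2, tx / 2, t'] : Fin 3 → ℝ) ∘ Equiv.swap (0 : Fin 3) 1 from by
        ext a; fin_cases a <;> simp [Equiv.swap_apply_def],
      hubbardHoppingFamily_reindex, hubbardStrainedTTPrimeFermionInteraction]
  rw [hubbardStrainedTTPrimeFermionInteraction, ← tiGroundEnergyDensityAt_hubbardHoppingFamily_comp_eq swapReflection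
    swapReflection swapReflection_injective swapReflection_injective swapReflection_swapReflection strainPair₁_ne_zero
    strainPair₂_ne_zero le_rfl strainPair₁_mem_thicken_one strainPair₂_mem_thicken_one
    (fun a => by rw [swapReflection_strainPair₁]; exact strainPair₁_mem_thicken_one _)
    (fun a => by
      rcases swapReflection_strainPair₂ a with h | h
      · rw [h]; exact strainPair₂_mem_thicken_one _
      · rw [h]; exact neg_mem_thicken_zero (strainPair₂_mem_thicken_one _)) U _ ρ, hfam]

/-- **The symmetric point of the strained family is the `t–t'` interaction**:
`Φ^{t,t,t',U} = Φ(t, t', U)` (term by term). [cite: XuEtAl2024, eq. (1)] -/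
theorem hubbardStrainedTTPrimeFermionInteraction_symm (t t' U : ℝ) :
    hubbardStrainedTTPrimeFermionInteraction t t t' U = hubbardTTPrimeFermionInteraction t t' U := by
  refine FermionInteraction.ext fun X => ?_
  rw [hubbardTTPrimeFermionInteraction_apply, hubbardFermionInteraction_apply_eq_onSite_add_sum_vectorHopping t U X,
    diagHoppingFermionInteraction_apply_eq_sum_vectorHopping, Fin.sum_univ_two, Fin.sum_univ_two,
    vectorHoppingFermionInteraction_eq_smul_one (unitVec 0) t, vectorHoppingFermionInteraction_eq_smul_one (unitVec 1) t,
    vectorHoppingFermionInteraction_eq_smul_one (diagVec 0) t', vectorHoppingFermionInteraction_eq_smul_one (diagVec 1) t']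
  rw [hubbardStrainedTTPrimeFermionInteraction, hubbardHoppingFamily, FermionInteraction.linearFamily_apply, Fin.sum_univ_three]
  simp only [hoppingPairInteraction_apply, strainPair₁, strainPair₂, Matrix.cons_val_zero, Matrix.cons_val_one,
    Matrix.cons_val_two, Matrix.head_cons, Matrix.tail_cons, smul_add, Complex.ofReal_div, Complex.ofReal_ofNat]
  rw [show ∀ A : FermionOp X, ((t : ℂ) / 2) • A + ((t : ℂ) / 2) • A = (t : ℂ) • A from fun A => by
      rw [← add_smul]; ring_nf,
    show ∀ A : FermionOp X, ((t : ℂ) / 2) • A + ((t : ℂ) / 2) • A = (t : ℂ) • A from fun A => by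
      rw [← add_smul]; ring_nf]
  abel

/-- **THE UNIAXIAL-STRAIN CAP.** At every filling and every `t_x, t_y, t', U`:
`e_ρ(t_x, t_y, t', U) ≤ e_ρ(t̄, t̄, t', U)` with `t̄ = (t_x + t_y)/2` — splitting the nearest-neighbour hopping
anisotropically at fixed mean never RAISES the ground-state energy density (symmetry + joint concavity).
[cite: Israel1979, Thm. I.3.4] -/
theorem tiGroundEnergyDensityAt_strained_le_symm (tx ty t' U ρ : ℝ) :
    (hubbardStrainedTTPrimeFermionInteraction tx ty t' U).tiGroundEnergyDensityAt 1 ρ ≤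
      (hubbardStrainedTTPrimeFermionInteraction ((tx + ty) / 2) ((tx + ty) / 2) t' U).tiGroundEnergyDensityAt 1 ρ := by
  have hc := concaveOn_tiGroundEnergyDensityAt_hubbardHoppingFamily strainPair₁ strainPair₂ U 1 ρ
  have h := concaveOn_le_map_midpoint_of_eq hc (x := ![tx / 2, ty / 2, t']) (y := ![ty / 2, tx / 2, t'])
    (tiGroundEnergyDensityAt_strained_swap tx ty t' U ρ)
  have hmid : (1 / 2 : ℝ) • (![tx / 2, ty / 2, t'] : Fin 3 → ℝ) + (1 / 2 : ℝ) • (![ty / 2, tx / 2, t'] : Fin 3 → ℝ) =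
      ![(tx + ty) / 2 / 2, (tx + ty) / 2 / 2, t'] := by
    ext a; fin_cases a <;> simp <;> ring
  rw [hmid] at h
  exact h

/-- **Strained models are capped by the certified symmetric energy density**: for `U ≥ 0`, `0 < ρ < 2`,
`e_ρ(t_x, t_y, t', U) ≤ energyDensityTT' ((t_x + t_y)/2) t' U ρ` — every certified CAP of the `t–t'` energy
density at the mean hopping is a cap for every uniaxially strained model with that mean.
[cite: Israel1979, Thm. I.3.4] -/
theorem tiGroundEnergyDensityAt_strained_le_energyDensityTT' (tx ty t' : ℝ) {U : ℝ} (hU : 0 ≤ U) {ρ : ℝ}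
    (hρ0 : 0 < ρ) (hρ2 : ρ < 2) :
    (hubbardStrainedTTPrimeFermionInteraction tx ty t' U).tiGroundEnergyDensityAt 1 ρ ≤
      energyDensityTT' ((tx + ty) / 2) t' U ρ := by
  rw [← tiGroundEnergyDensityAt_hubbardTTPrime_eq_energyDensityTT' _ t' hU hρ0 hρ2,
    ← hubbardStrainedTTPrimeFermionInteraction_symm]
  exact tiGroundEnergyDensityAt_strained_le_symm tx ty t' U ρ

/-- **Cap form for consumers**: a certified cap `energyDensityTT' t̄ t' U ρ ≤ hi` at the mean hopping
`t̄ = (t_x + t_y)/2` caps the strained model: `e_ρ(t_x, t_y, t', U) ≤ hi`. [cite: Israel1979, Thm. I.3.4] -/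
theorem tiGroundEnergyDensityAt_strained_le_of_cap (tx ty t' : ℝ) {U : ℝ} (hU : 0 ≤ U) {ρ : ℝ}
    (hρ0 : 0 < ρ) (hρ2 : ρ < 2) {hi : ℝ} (hcap : energyDensityTT' ((tx + ty) / 2) t' U ρ ≤ hi) :
    (hubbardStrainedTTPrimeFermionInteraction tx ty t' U).tiGroundEnergyDensityAt 1 ρ ≤ hi :=
  (tiGroundEnergyDensityAt_strained_le_energyDensityTT' tx ty t' hU hρ0 hρ2).trans hcap

/-- **Floor side (kinematic)**: the strained density is within `(16/π²)·|t_x − t_y|/2`… more precisely, moving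
`(t_x/2, t_y/2)` to `(t̄/2, t̄/2)` costs at most `4 · (|t_x − t̄| + |t_y − t̄|)/2 = 2|t_x − t_y|` by the norm
(the pairs `(e₁|e₁)`, `(e₂|e₂)` are not rank-2, so only the norm row applies):
`energyDensityTT' t̄ t' U ρ − 2|t_x − t_y| ≤ e_ρ(t_x, t_y, t', U)`. [cite: Israel1979, Thm. I.3.4] -/
theorem energyDensityTT'_sub_le_tiGroundEnergyDensityAt_strained (tx ty t' : ℝ) {U : ℝ} (hU : 0 ≤ U) {ρ : ℝ}
    (hρ0 : 0 < ρ) (hρ2 : ρ < 2) :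
    energyDensityTT' ((tx + ty) / 2) t' U ρ - 2 * |tx - ty| ≤
      (hubbardStrainedTTPrimeFermionInteraction tx ty t' U).tiGroundEnergyDensityAt 1 ρ := by
  have h := abs_infMeanEnergyOn_hubbardHoppingFamily_sub_le_norm strainPair₁ strainPair₂ U
    {ω : InfVolFermionState 2 | ω.IsTranslationInvariant ∧ ω.density = ρ} (R := 1) strainPair₁_ne_zero strainPair₂_ne_zero
    strainPair₁_mem_thicken_one strainPair₂_mem_thicken_one ![tx / 2, ty / 2, t'] ![(tx + ty) / 2 / 2, (tx + ty) / 2 / 2, t']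
  rw [← FermionInteraction.tiGroundEnergyDensityAt_eq_infMeanEnergyOn, ← FermionInteraction.tiGroundEnergyDensityAt_eq_infMeanEnergyOn]
    at h
  have hsum : ∑ a : Fin 3, 4 * |(![tx / 2, ty / 2, t'] : Fin 3 → ℝ) a - (![(tx + ty) / 2 / 2, (tx + ty) / 2 / 2, t'] : Fin 3 → ℝ) a| =
      2 * |tx - ty| := by
    rw [Fin.sum_univ_three]
    simp only [Matrix.cons_val_zero, Matrix.cons_val_one, Matrix.cons_val_two, Matrix.head_cons, Matrix.tail_cons,
      sub_self, abs_zero, mul_zero, add_zero]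
    rw [show tx / 2 - (tx + ty) / 2 / 2 = (tx - ty) / 4 by ring, show ty / 2 - (tx + ty) / 2 / 2 = -((tx - ty) / 4) by ring,
      abs_neg, abs_div, abs_of_pos (by norm_num : (0 : ℝ) < 4)]
    ring
  rw [hsum] at h
  have hsymm : (hubbardHoppingFamily strainPair₁ strainPair₂ U ![(tx + ty) / 2 / 2, (tx + ty) / 2 / 2, t']).tiGroundEnergyDensityAt 1 ρ =
      energyDensityTT' ((tx + ty) / 2) t' U ρ := by
    rw [show hubbardHoppingFamily strainPair₁ strainPair₂ U ![(tx + ty) / 2 / 2, (tx + ty) / 2 / 2, t'] =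
        hubbardStrainedTTPrimeFermionInteraction ((tx + ty) / 2) ((tx + ty) / 2) t' U from rfl,
      hubbardStrainedTTPrimeFermionInteraction_symm, tiGroundEnergyDensityAt_hubbardTTPrime_eq_energyDensityTT' _ t' hU hρ0 hρ2]
  rw [hsymm, show hubbardHoppingFamily strainPair₁ strainPair₂ U ![tx / 2, ty / 2, t'] =
      hubbardStrainedTTPrimeFermionInteraction tx ty t' U from rfl] at h
  have h' := (abs_sub_le_iff.1 h).2
  linarith

end Strain

end Literature.MathematicalPhysics.QuantumLattice

end
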